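import Literature.IUT.LogVolume.GenuineTowerLocalType
import Literature.NumberTheory.EllipticCurves.LegendreSemistableReductionProofs
import HarnessLib

/-!
# The ramification of a field pinned by the v3 Θ-datum DIVIDES `15` at a place `v ∤ 30` where the Legendre curve is
# MULTIPLICATIVE over `F_tpd` itself and `λ`, `λ − 1` have EVEN order («k-parity» sharpening of the LOCAL-TYPE lemma
# of the abc-iut R-W window table; proof-only)

Mochizuki, *Inter-universal Teichmüller theory IV* (RIMS manuscript Apr. 2020 = PRIMS **57** (2021)), Thm. 1.10,
Step (ii) p. 24 and Step (iii) (R2)–(R4) p. 25–26 (ramification budget of the layer `F/F_tpd`); J. H. Silverman,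
*The Arithmetic of Elliptic Curves*, 2nd ed. (2009), proof of Prop. VII.5.4 (c), Case 3 (the substitution `x = λx′`,
`y = λ^{3/2}y′`) and Prop. VII.5.1 (b); J. H. Silverman, *Advanced Topics* (1994), V.4–V.5, Exercise 5.13 (b) (at a
place `v ∤ p` of MULTIPLICATIVE reduction inertia acts on `E[p]` through `(1 *; 0 1)`: image of order dividing `p`).

abc-iut-W-neg-1's `Cor22.ramificationIdx_subThetaField_dvd_sixty` (`SubThetaFieldRamificationSixty.lean`) proves
`e(w | v) ∣ 60 = 2·3·5·2` at every BAD place `v ∤ 30` of a field with `IsSubThetaField P F`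
(`F ⊆ F_tpd(√−1, √λ, √(λ−1), E_λ[15])`): one factor `2` is the index of `Γ_{F_tpd(√d)}` for a multiplicative
quadratic twist `E_λ^{(d)}`, the other the square-root fixer left over after inertia has fixed `√−1` and the ONE
radicand among `λ, λ−1, λ(λ−1)` of even order. THIS FILE removes BOTH factors `2` when `E_λ` ITSELF is multiplicative
at `v` and BOTH `λ`, `λ − 1` have even `v`-order:
* `Literature.NumberTheory.EllipticCurves.legendre_hasMultiplicativeReductionAt_of_one_lt_valuation_of_valuation_sq_eq`
  — Silverman's Case 3 over `K` itself when `|λ|_v = |d|_v² > 1` for some `d ∈ K`: `⟨d, 0, 0, 0⟩ • (y² = x(x−1)(x−λ))`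
  is `v`-integral with `|c₄|_v = 1`, `|Δ|_v = |λ|_v⁻² < 1`, so `E_λ` is MULTIPLICATIVE at `v` over `K`;
* **`Cor22.ramificationIdx_subThetaField_dvd_fifteen`** — `P ∈ U`, `F` Galois/`F_tpd` with `IsSubThetaField P F`,
  `w | v`, `v ∤ 30`, `E_λ` multiplicative at `v`, `v(λ) = exp(2m)`, `v(λ−1) = exp(2m′)` ⟹ **`e(w | v) ∣ 15`** (the
  Sixty proof with both index-`2` steps removed: inertia fixes `√−1`, `√λ`, `√(λ−1)`; its images in `Aut(E_λ[3])`,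
  `Aut(E_λ[5])` have orders `∣ 3`, `∣ 5` by the tree's `natCard_map_inertia_galoisRepTorsion_dvd_prime`);
* `Cor22.ThetaVolumeDatumAt.ramificationIdx_int_dvd_fifteen_mul` / `…_ratPoint'` — tower form at a genuine Θ-volume
  datum: `e(u | p) ∣ e(v₀ | p)·15·l`, and `∣ 15·l` at a RATIONAL point, for places `u` of the `l`-division field of
  residue characteristic `p ∉ {2, 3, 5, l}` (the `K/F` layer `e(u|w) ∣ l` is abc-iut-S-d1's `ramificationIdx_dvd_prime`,
  BY NAME as in `GenuineTowerLocalType.lean`).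
Consumer: at `λ_k = 1/2 + 2/7^k` with `k` EVEN both hypotheses hold at `7` over `ℚ` (abc-iut-w5-d163's «k-parity» row),
so `e(K_x/ℚ_7) ∣ 15·l` at every place over `7` (`Summits/ABC/IUTFork/Cor312GenuineKLocalTypeEven`). Proof-only
(no definition, no named fact, no instance); classical; TAKES NO SIDE on [IUTchIII] Cor. 3.12.
-/

noncomputable section

open scoped Classical

/-! ## Silverman VII.5.4 (c), Case 3 over `K`: `|λ|_v = |d|_v² > 1` ⟹ multiplicative reduction -/

namespace Literature.NumberTheory.EllipticCurves

open IsDedekindDomain _root_.WeierstrassCurve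

section Reduction

variable {A : Type*} [CommRing A] [IsDedekindDomain A] {K : Type*} [Field K] [Algebra A K]
  [IsFractionRing A K] (v : HeightOneSpectrum A) {la : K}

/-- **Case (3) over `K` when `|λ|_v = |d|_v² > 1` for some `d ∈ K`: MULTIPLICATIVE reduction** (`|2|_v = 1`). The
change of variables `u = d` (`x = d²x′`, `y = d³y′`) gives a `v`-integral equation with `|c₄|_v = |d|_v⁻⁴·|λ² − λ + 1|_v = 1`
and `|Δ|_v = |d|_v⁻¹²·|λ|_v²|λ−1|_v² = |λ|_v⁻² < 1` (Prop. VII.5.1 (b)); the reduction type does not depend on the equation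
(`hasMultiplicativeReductionAt_smul_iff_holds`). Silverman, *AEC*, proof of Prop. VII.5.4 (c), Case 3, over `K` itself when
`ord_v λ` is even. [cite: SilvermanAEC2009, proof of Prop. VII.5.4(c), Case 3 (PDF p. 177) and Prop. VII.5.1(b)] -/
theorem legendre_hasMultiplicativeReductionAt_of_one_lt_valuation_of_valuation_sq_eq
    (h2 : v.valuation K (2 : K) = 1) [hE : (⟨0, -(1 + la), 0, la, 0⟩ : WeierstrassCurve K).IsElliptic]
    (hla : 1 < v.valuation K la) {d : K} (hd : v.valuation K d ^ 2 = v.valuation K la) :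
    (⟨0, -(1 + la), 0, la, 0⟩ : WeierstrassCurve K).HasMultiplicativeReductionAt v := by
  set W : WeierstrassCurve K := ⟨0, -(1 + la), 0, la, 0⟩ with hW
  set val := v.valuation K with hval
  have hla0 : val la ≠ 0 := (lt_trans zero_lt_one hla).ne'
  have hd0 : d ≠ 0 := by
    rintro rfl
    rw [Valuation.map_zero, zero_pow two_ne_zero] at hd
    exact hla0 hd.symm
  -- `|1 + λ|_v = |λ|_v`, `|λ − 1|_v = |λ|_v`, `|λ² − λ + 1|_v = |λ|_v²`
  have h1l : val (1 + la) = val la := by rw [add_comm, Valuation.map_add_eq_of_lt_left _ (by rwa [Valuation.map_one])]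
  have hl1 : val (la - 1) = val la := by rw [Valuation.map_sub_eq_of_lt_left _ (by rwa [Valuation.map_one])]
  have hq : val (la ^ 2 - la + 1) = val la ^ 2 := by
    have hlt2 : val la < val la ^ 2 := by
      conv_lhs => rw [← pow_one (val la)]
      exact pow_lt_pow_right₀ hla one_lt_two
    rw [show la ^ 2 - la + 1 = la ^ 2 - (la - 1) by ring,
      Valuation.map_sub_eq_of_lt_left _ (by rwa [map_pow, hl1]), map_pow]
  -- the rescaled equation
  set C : VariableChange K := ⟨Units.mk0 d hd0, 0, 0, 0⟩ with hC
  have hu : ((C.u⁻¹ : Kˣ) : K) = d⁻¹ := by rw [Units.val_inv_eq_inv_val, hC, Units.val_mk0]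
  have hvu : ∀ n : ℕ, val (((C.u⁻¹ : Kˣ) : K) ^ n) = (val d ^ n)⁻¹ := fun n => by
    rw [map_pow, hu, map_inv₀, inv_pow]
  have ha₁ : (C • W).a₁ = 0 := by simp [variableChange_a₁, hC, hW]
  have ha₂ : (C • W).a₂ = ((C.u⁻¹ : Kˣ) : K) ^ 2 * (-(1 + la)) := by simp [variableChange_a₂, hC, hW]
  have ha₃ : (C • W).a₃ = 0 := by simp [variableChange_a₃, hC, hW]
  have ha₄ : (C • W).a₄ = ((C.u⁻¹ : Kˣ) : K) ^ 4 * la := by simp [variableChange_a₄, hC, hW]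
  have ha₆ : (C • W).a₆ = 0 := by simp [variableChange_a₆, hC, hW]
  -- integrality: `|a₂'| = 1`, `|a₄'| = |λ|⁻¹ ≤ 1`
  have hint : (C • W).IsIntegralAt v := by
    refine isIntegralAt_of_valuation_le_one v _ (by rw [ha₁, Valuation.map_zero]; exact zero_le_one) ?_
      (by rw [ha₃, Valuation.map_zero]; exact zero_le_one) ?_ (by rw [ha₆, Valuation.map_zero]; exact zero_le_one)
    · rw [ha₂, map_mul, Valuation.map_neg, ← hval, hvu 2, h1l, hd, inv_mul_cancel₀ hla0]
    · rw [ha₄, map_mul, ← hval, hvu 4, show (4 : ℕ) = 2 * 2 by norm_num, pow_mul, hd]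
      rw [show (val la ^ 2)⁻¹ * val la = (val la)⁻¹ by field_simp]
      exact inv_le_one_of_one_le₀ hla.le
  -- `|c₄'| = 1`
  have hc₄ : v.valuation K (C • W).c₄ = 1 := by
    rw [variableChange_c₄, map_mul, ← hval, hvu 4, show (4 : ℕ) = 2 * 2 by norm_num, pow_mul, hd]
    have h := valuation_legendre_c₄ v h2 la
    rw [← hW, ← hval] at h
    rw [h, hq, inv_mul_cancel₀ (pow_ne_zero _ hla0)]
  -- `|Δ'| = |λ|⁻² < 1`
  have hΔ : v.valuation K (C • W).Δ < 1 := by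
    rw [variableChange_Δ, map_mul, ← hval, hvu 12, show (12 : ℕ) = 2 * 6 by norm_num, pow_mul, hd]
    have h := valuation_legendre_Δ v h2 la
    rw [← hW, ← hval] at h
    rw [h, hl1, ← pow_add, show (2 + 2 : ℕ) = 4 by norm_num]
    rw [show (val la ^ 6)⁻¹ * val la ^ 4 = (val la ^ 2)⁻¹ by field_simp]
    exact inv_lt_one_of_one_lt₀ (one_lt_pow₀ hla two_ne_zero)
  have hmul : (C • W).HasMultiplicativeReductionAt v := hasMultiplicativeReductionAt_of_valuation_c₄_eq_one hint hc₄ hΔ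
  exact (hasMultiplicativeReductionAt_smul_iff_holds v W C).mp hmul

end Reduction

end Literature.NumberTheory.EllipticCurves

/-! ## The divisibility `e(w | v) ∣ 15` at a MULTIPLICATIVE place with `ord_v λ`, `ord_v(λ−1)` even, `v ∤ 30` -/

namespace Literature.IUT.LogVolume

namespace Cor22

open NumberField IsDedekindDomain Literature.NumberTheory.DiophantineGeometry.GenEll
open Literature.NumberTheory.EllipticCurves Literature.NumberTheory.GaloisRepresentations
open Literature.NumberTheory.NumberFields WeierstrassCurve IntermediateField Field

variable {P : NFPoint} (F : Type) [Field F] [NumberField F] [Algebra P.F F]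

/-- **`e(w | v) ∣ 15`** for every place `w` of a field pinned by `IsSubThetaField P F` (Galois over `F_tpd`) over a place
`v ∤ 2·3·5` of `F_tpd` at which `E_λ` has MULTIPLICATIVE reduction over `F_tpd` and `λ`, `λ − 1` have EVEN `v`-order: the
absolute inertia group `I` at `v` fixes `√−1`, `√λ`, `√(λ−1)`, and its images in `Aut(E_λ[3])`, `Aut(E_λ[5])` have orders
`∣ 3`, `∣ 5` (Silverman *ATAEC* V Ex. 5.13 (b); the tree's `natCard_map_inertia_galoisRepTorsion_dvd_prime`), so
`e(w|v) ∣ [I : I ∩ ker ρ̄₃ ∩ ker ρ̄₅ ∩ fixers] ∣ 3·5` — abc-iut-W-neg-1's Sixty proof with both index-`2` steps removed.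
[cite: SilvermanATAEC1994, V.4–V.5 and Exercise 5.13 (b)] [cite: Mochizuki2012, IUTchIV Thm 1.10 proof Step (iii) (R2)–(R4) p.25–26] -/
theorem ramificationIdx_subThetaField_dvd_fifteen (hU : P.InU) (hF : IsSubThetaField P F) [IsGalois P.F F]
    (w : HeightOneSpectrum (𝓞 F))
    (hmult : P.legendreCurve.HasMultiplicativeReductionAt (finBelow P.F F w))
    (hev : ∃ m : ℤ, (finBelow P.F F w).valuation P.F P.x = WithZero.exp (2 * m))
    (hev1 : ∃ m : ℤ, (finBelow P.F F w).valuation P.F (P.x - 1) = WithZero.exp (2 * m))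
    (h30 : ((30 : ℕ) : 𝓞 P.F) ∉ (finBelow P.F F w).asIdeal) :
    w.asIdeal.ramificationIdx (𝓞 P.F) ∣ 15 := by
  -- adapted from abc-iut-W-neg-1's `ramificationIdx_subThetaField_dvd_sixty` (SubThetaFieldRamificationSixty.lean)
  haveI : P.legendreCurve.IsElliptic := P.legendreCurve_isElliptic_iff.2 hU
  haveI : Fact (Nat.Prime 3) := ⟨Nat.prime_three⟩
  haveI : Fact (Nat.Prime 5) := ⟨Nat.prime_five⟩
  set v := finBelow P.F F w with hvdef
  haveI := v.isPrime
  -- residue characteristic `∉ {2, 3, 5}`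
  have hdv : ∀ a b : ℕ, 30 = a * b → ((b : ℕ) : 𝓞 P.F) ∉ v.asIdeal := fun a b hab h =>
    h30 (by rw [hab, Nat.cast_mul]; exact Ideal.mul_mem_left _ _ h)
  have h2 := hdv 15 2 rfl; have h3 := hdv 10 3 rfl; have h5 := hdv 6 5 rfl
  have h2' : (2 : 𝓞 P.F) ∉ v.asIdeal := by exact_mod_cast h2
  have h3' : (3 : 𝓞 P.F) ∉ v.asIdeal := by exact_mod_cast h3
  have h5' : (5 : 𝓞 P.F) ∉ v.asIdeal := by exact_mod_cast h5
  -- `F ≃ L := F_tpd(φ S) ⊆ F̄_tpd`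
  haveI : FiniteDimensional P.F F := Module.Finite.of_restrictScalars_finite ℚ P.F F
  set Ω := AlgebraicClosure P.F
  let φ : F →ₐ[P.F] Ω := IsAlgClosed.lift
  set S : Set F := subThetaFieldGenerators P F with hSdef
  set L : IntermediateField P.F Ω := IntermediateField.adjoin P.F (φ '' S) with hLdef
  have hL : φ.fieldRange = L := by
    rw [AlgHom.fieldRange_eq_map, ← hF.adjoin_eq_top, IntermediateField.adjoin_map]
  let e : F ≃ₐ[P.F] L :=
    (((IntermediateField.topEquiv (F := P.F) (E := F)).symm.trans (IntermediateField.equivMap ⊤ φ)).trans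
      (IntermediateField.equivOfEq (AlgHom.fieldRange_eq_map φ).symm)).trans
      (IntermediateField.equivOfEq hL)
  haveI : FiniteDimensional P.F L := LinearEquiv.finiteDimensional e.toLinearEquiv
  haveI : IsGalois P.F L := IsGalois.of_algEquiv e
  haveI : NumberField L := NumberField.of_module_finite P.F L
  -- absolute inertia at `v`
  obtain ⟨𝔓, h𝔓⟩ := HeightOneSpectrum.primesAbove_nonempty v
  haveI : 𝔓.IsPrime := h𝔓.1
  haveI : 𝔓.LiesOver v.asIdeal := h𝔓.2
  set I : Subgroup (absoluteGaloisGroup P.F) := 𝔓.inertia (absoluteGaloisGroup P.F) with hIdef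
  have h4 : ((4 : ℕ) : 𝓞 P.F) ∉ v.asIdeal := by
    intro h
    have : ((2 : ℕ) : 𝓞 P.F) * ((2 : ℕ) : 𝓞 P.F) ∈ v.asIdeal := by
      rw [← Nat.cast_mul]; exact h
    rcases (Ideal.IsPrime.mem_or_mem inferInstance this) with h' | h' <;> exact h2 h'
  obtain ⟨m, hm⟩ := hev
  obtain ⟨m1, hm1⟩ := hev1
  -- (1) `I ≤ A := sqrtFixer(−1) ⊓ (sqrtFixer(λ) ⊓ sqrtFixer(λ−1))`: all three square roots are fixed by inertia
  set A : Subgroup (absoluteGaloisGroup P.F) :=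
    sqrtFixer P (-1) ⊓ (sqrtFixer P P.x ⊓ sqrtFixer P (P.x - 1)) with hAdef
  have hIA : I ≤ A := by
    intro σ hσ
    refine ⟨mem_fixingSubgroup_adjoin_of_forall_eq (σ := Field.absoluteGaloisGroup.toAlgEquiv P.F σ)
        fun z hz => ?_,
      mem_fixingSubgroup_adjoin_of_forall_eq (σ := Field.absoluteGaloisGroup.toAlgEquiv P.F σ) fun z hz => ?_,
      mem_fixingSubgroup_adjoin_of_forall_eq (σ := Field.absoluteGaloisGroup.toAlgEquiv P.F σ) fun z hz => ?_⟩
    · -- `z² = −1`: `z⁴ = 1`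
      have hz : z ^ 2 = algebraMap P.F Ω (-1) := hz
      have hz4 : z ^ 4 = 1 := by
        rw [show (4 : ℕ) = 2 * 2 by norm_num, pow_mul, hz, map_neg, map_one]; norm_num
      exact smul_eq_of_mem_inertia_of_pow_eq_one v h𝔓 hσ h4 hz4
    · -- `z² = λ`, `λ` of even `v`-order
      exact smul_eq_of_mem_inertia_of_sq_eq_of_valuation_eq_exp_even v h𝔓 hσ h2' hm hz
    · -- `z² = λ − 1`, `λ − 1` of even `v`-order
      exact smul_eq_of_mem_inertia_of_sq_eq_of_valuation_eq_exp_even v h𝔓 hσ h2' hm1 hz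
  -- (2) the gens-fixer `H ≤ Gal(F̄_tpd/L)`
  set K3 : Subgroup (absoluteGaloisGroup P.F) := (P.legendreCurve.galoisRepTorsion ((3 : ℕ) : ℤ)).ker with hK3
  set K5 : Subgroup (absoluteGaloisGroup P.F) := (P.legendreCurve.galoisRepTorsion ((5 : ℕ) : ℤ)).ker with hK5
  set H : Subgroup (absoluteGaloisGroup P.F) :=
    K3 ⊓ K5 ⊓ (sqrtFixer P (-1) ⊓ (sqrtFixer P P.x ⊓ sqrtFixer P (P.x - 1))) with hHdef
  have hHN : H ≤ L.fixingSubgroup := by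
    intro τ hτ
    refine mem_fixingSubgroup_adjoin_of_forall_eq (σ := Field.absoluteGaloisGroup.toAlgEquiv P.F τ) fun s hs => ?_
    obtain ⟨x, hx, rfl⟩ := hs
    rcases hx with (hsq | hsq | hsq) | htor
    · -- `x² = −1`
      have : (φ x) ^ 2 = algebraMap P.F Ω (-1) := by rw [← map_pow, hsq, map_neg, map_one, map_neg, map_one]
      exact forall_eq_of_mem_fixingSubgroup_adjoin hτ.2.1 _ this
    · -- `x² = λ`
      have : (φ x) ^ 2 = algebraMap P.F Ω P.x := by rw [← map_pow, hsq, φ.commutes]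
      exact forall_eq_of_mem_fixingSubgroup_adjoin hτ.2.2.1 _ this
    · -- `x² = λ − 1`
      have : (φ x) ^ 2 = algebraMap P.F Ω (P.x - 1) := by
        rw [← map_pow, hsq, map_sub, map_one, φ.commutes, map_sub, map_one]
      exact forall_eq_of_mem_fixingSubgroup_adjoin hτ.2.2.2 _ this
    · -- a `15`-torsion coordinate: transport the point to `E_λ(F̄_tpd)`
      rw [torsionCoords_eq] at htor
      obtain ⟨T, hT, hxT⟩ := Set.mem_iUnion₂.1 htor
      have hT15 : (15 : ℤ) • T = 0 := hT
      let T' : geomPoints P.legendreCurve := Affine.Point.map (W' := P.legendreCurve.toAffine) φ T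
      have hT' : (15 : ℤ) • T' = 0 := by
        change (15 : ℤ) • Affine.Point.map (W' := P.legendreCurve.toAffine) φ T = 0
        rw [← map_zsmul, hT15, map_zero]
      have h3' : ∀ Q : geomTorsion P.legendreCurve ((3 : ℕ) : ℤ), τ • Q = Q := by
        intro Q
        have hQ := galoisRepTorsion_apply P.legendreCurve ((3 : ℕ) : ℤ) τ Q
        rw [(MonoidHom.mem_ker).1 hτ.1.1] at hQ
        exact hQ.symm
      have h5' : ∀ Q : geomTorsion P.legendreCurve ((5 : ℕ) : ℤ), τ • Q = Q := by
        intro Q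
        have hQ := galoisRepTorsion_apply P.legendreCurve ((5 : ℕ) : ℤ) τ Q
        rw [(MonoidHom.mem_ker).1 hτ.1.2] at hQ
        exact hQ.symm
      have hfix : τ • T' = T' := smul_eq_of_fifteen τ h3' h5' T' hT'
      refine forall_coords_of_smul_eq P τ T' hfix (φ x) ?_
      rcases T with _ | ⟨a, b, hab⟩
      · simp [pointCoords] at hxT
      · change φ x ∈ pointCoords (Affine.Point.map (W' := P.legendreCurve.toAffine) φ
          (Affine.Point.some a b hab))
        rw [Affine.Point.map_some]
        simp only [pointCoords, Set.mem_insert_iff, Set.mem_singleton_iff] at hxT ⊢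
        rcases hxT with rfl | rfl
        · exact Or.inl rfl
        · exact Or.inr rfl
  -- (3) index bookkeeping along `I ≥ K3 ⊓ I ≥ K5 ⊓ (K3 ⊓ I)`: `[I : I ∩ K3 ∩ K5] ∣ 3·5` (NO twist, NO left-over root)
  have hK3r : K3.relIndex I ∣ 3 := by
    rw [hK3, Subgroup.relIndex_ker]
    exact P.legendreCurve.natCard_map_inertia_galoisRepTorsion_dvd_prime Nat.prime_three hmult h3' h𝔓
  have hK5r : K5.relIndex (K3 ⊓ I) ∣ 5 := by
    rw [hK5, Subgroup.relIndex_ker]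
    have h5I : Nat.card (I.map (P.legendreCurve.galoisRepTorsion ((5 : ℕ) : ℤ))) ∣ 5 :=
      P.legendreCurve.natCard_map_inertia_galoisRepTorsion_dvd_prime Nat.prime_five hmult h5' h𝔓
    exact (Subgroup.card_dvd_of_le (Subgroup.map_mono inf_le_right)).trans h5I
  have hG : (K5 ⊓ K3).relIndex I ∣ 15 := by
    rw [← Subgroup.relIndex_inf_mul_relIndex K5 K3 I]
    have h := mul_dvd_mul hK5r hK3r
    simpa using h
  -- `H ⊓ I ⊇ (K5 ⊓ K3) ⊓ I` (as `I ≤ A`), so `[I : H ∩ I] ∣ 15`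
  have hHr : H.relIndex I ∣ 15 := by
    have hle : K5 ⊓ K3 ⊓ I ≤ H := by
      intro τ hτ
      exact ⟨⟨hτ.1.2, hτ.1.1⟩, hIA hτ.2⟩
    have h := Subgroup.relIndex_dvd_of_le_left I hle
    rw [Subgroup.inf_relIndex_right] at h
    exact h.trans hG
  -- (4) `e(w | v)`, read on the inertia group of `Gal(L/F_tpd)`, divides `[I : I ∩ Gal(F̄/L)] ∣ [I : I ∩ H]`
  set Q : Ideal (𝓞 L) := w.asIdeal.map (RingOfIntegers.mapAlgEquiv e : 𝓞 F ≃ₐ[𝓞 P.F] 𝓞 L) with hQ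
  haveI : Q.IsPrime := isPrime_map_mapAlgEquiv e w
  haveI : Q.LiesOver v.asIdeal := liesOver_map_mapAlgEquiv e w _
  rw [← ramificationIdx_map_mapAlgEquiv e w]
  set r : absoluteGaloisGroup P.F →* (L ≃ₐ[P.F] L) := AlgEquiv.restrictNormalHom L with hr
  have hker : r.ker = L.fixingSubgroup := IntermediateField.restrictNormalHom_ker L
  have h1 : (𝔓.comap (ringOfIntegersToIntegralClosure (k := P.F) (Ω := Ω) L)).inertia (L ≃ₐ[P.F] L) ≤
      I.map r := by
    intro g hg
    obtain ⟨σ, hσ, hσg⟩ := @exists_mem_inertia_restrict_eq P.F _ _ L _ _ 𝔓 h𝔓.1 g hg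
    refine ⟨σ, hσ, AlgEquiv.ext fun x => Subtype.ext ?_⟩
    change (algebraMap L Ω) ((σ.restrictNormal L) x) = (algebraMap L Ω) (g x)
    rw [AlgEquiv.restrictNormal_commutes]
    exact hσg x
  have key : Q.ramificationIdx (𝓞 P.F) ∣ 15 := by
    rw [@ramificationIdx_eq_card_inertia_comap P.F _ _ L _ _ v 𝔓 h𝔓.1 h𝔓.2 Q _ _]
    have hdvd : Nat.card ((𝔓.comap (ringOfIntegersToIntegralClosure (k := P.F) (Ω := Ω) L)).inertia
        (L ≃ₐ[P.F] L)) ∣ L.fixingSubgroup.relIndex I := by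
      have h := Subgroup.card_dvd_of_le h1
      rwa [← Subgroup.relIndex_ker I r, hker] at h
    exact hdvd.trans ((Subgroup.relIndex_dvd_of_le_left I hHN).trans hHr)
  exact key

/-! ## At a genuine Θ-volume datum: the tower form `e(u | p) ∣ e(v₀ | p)·15·l` -/

namespace ThetaVolumeDatumAt

open Literature.IUT.HodgeTheaters

variable {l : ℕ} (T : ThetaVolumeDatumAt P l)

/-- **THE SHARPENED LOCAL TYPE: `e(u | p) ∣ e(v₀ | p)·15·l`** for every place `u` of the `l`-division field `K` of a genuine
Θ-volume datum, of residue characteristic `p ∉ {2, 3, 5, l}`, whose restriction `v₀ = u ∩ F_tpd` is a place where `E_λ` is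
multiplicative over `F_tpd` and `λ`, `λ − 1` have even order (`e(u|p) = e(v₀|p)·e(w|v₀)·e(u|w)`; `e(u|w) ∣ l` is abc-iut-S-d1's
`ramificationIdx_dvd_prime`). [cite: Mochizuki2012, IUTchIV Thm. 1.10 proof Steps (ii)–(iii) p. 24–26] [claim: Mochizuki2012, status: disputed] -/
theorem ramificationIdx_int_dvd_fifteen_mul
    (u : letI := T.instFieldK; letI := T.instNumberFieldK; HeightOneSpectrum (𝓞 T.K))
    (hu : letI := T.instFieldK; letI := T.instNumberFieldK; residueChar T.K u ∉ ({2, 3, 5, l} : Finset ℕ))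
    (hmult : letI := T.instFieldF; letI := T.instNumberFieldF; letI := T.instAlgebraF; letI := T.instFieldK
      letI := T.instNumberFieldK; letI := T.instAlgebraK
      P.legendreCurve.HasMultiplicativeReductionAt (finBelow P.F T.F (finBelow T.F T.K u)))
    (hev : letI := T.instFieldF; letI := T.instNumberFieldF; letI := T.instAlgebraF; letI := T.instFieldK
      letI := T.instNumberFieldK; letI := T.instAlgebraK
      ∃ m : ℤ, (finBelow P.F T.F (finBelow T.F T.K u)).valuation P.F P.x = WithZero.exp (2 * m))
    (hev1 : letI := T.instFieldF; letI := T.instNumberFieldF; letI := T.instAlgebraF; letI := T.instFieldK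
      letI := T.instNumberFieldK; letI := T.instAlgebraK
      ∃ m : ℤ, (finBelow P.F T.F (finBelow T.F T.K u)).valuation P.F (P.x - 1) = WithZero.exp (2 * m)) :
    (letI := T.instFieldK; letI := T.instNumberFieldK
     u.asIdeal.ramificationIdx ℤ) ∣
      (letI := T.instFieldF; letI := T.instNumberFieldF; letI := T.instAlgebraF; letI := T.instFieldK
       letI := T.instNumberFieldK; letI := T.instAlgebraK
       (finBelow P.F T.F (finBelow T.F T.K u)).asIdeal.ramificationIdx ℤ) * 15 * l := by
  -- adapted from abc-iut-W-neg-1's `ramificationIdx_int_dvd_sixty_mul` (GenuineTowerLocalType.lean)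
  letI := T.instFieldF; letI := T.instNumberFieldF; letI := T.instAlgebraF; letI := T.instFieldK
  letI := T.instNumberFieldK; letI := T.instAlgebraK; letI := T.instFieldFbar; letI := T.instAlgebraFbar
  letI := T.instAlgebraKFbar; letI := T.instIsElliptic
  simp only [Finset.mem_insert, Finset.mem_singleton, not_or] at hu
  obtain ⟨h2, h3, h5, hul⟩ := hu
  set w := finBelow T.F T.K u with hwdef
  set v₀ := finBelow P.F T.F w with hv₀def
  have hw : residueChar T.F w ∉ ({2, 3, 5} : Finset ℕ) := by
    rw [hwdef, residueChar_finBelow]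
    simp only [Finset.mem_insert, Finset.mem_singleton, not_or]
    exact ⟨h2, h3, h5⟩
  have hKF : u.asIdeal.ramificationIdx (𝓞 T.F) ∣ l := T.ramificationIdx_dvd_prime u hul
  haveI : IsGalois P.F T.F := (T.towerFacts T.inU).1
  have hFtpd : w.asIdeal.ramificationIdx (𝓞 P.F) ∣ 15 :=
    ramificationIdx_subThetaField_dvd_fifteen T.F T.inU T.isSubThetaField w hmult hev hev1
      (thirty_notMem_finBelow_of_residueChar_notMem w hw)
  -- `e(u|p) = e(v₀|p)·e(w|v₀)·e(u|w)`
  have hw_under : u.under (𝓞 T.F) = w := rfl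
  have hv_under : w.under (𝓞 P.F) = v₀ := rfl
  haveI : w.asIdeal.IsMaximal := w.isMaximal
  haveI : v₀.asIdeal.IsMaximal := v₀.isMaximal
  have heuw : Ideal.ramificationIdx' w.asIdeal u.asIdeal = u.asIdeal.ramificationIdx (𝓞 T.F) :=
    Ideal.ramificationIdx'_eq_ramificationIdx w.asIdeal u.asIdeal w.ne_bot
  have hewv : Ideal.ramificationIdx' v₀.asIdeal w.asIdeal = w.asIdeal.ramificationIdx (𝓞 P.F) :=
    Ideal.ramificationIdx'_eq_ramificationIdx v₀.asIdeal w.asIdeal v₀.ne_bot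
  have heu : u.asIdeal.ramificationIdx ℤ =
      v₀.asIdeal.ramificationIdx ℤ * w.asIdeal.ramificationIdx (𝓞 P.F) * u.asIdeal.ramificationIdx (𝓞 T.F) := by
    rw [ThetaData.absRamificationIdx_eq_ramIdx_mul (F := T.F) u, hw_under,
      ramIdx_eq, ThetaData.absRamificationIdx_eq_ramIdx_mul (F := P.F) w, hv_under, ramIdx_eq, heuw, hewv]
  rw [heu]
  exact mul_dvd_mul (mul_dvd_mul dvd_rfl hFtpd) hKF

/-- **At a RATIONAL point: `e(u | p) ∣ 15·l`** for every place `u` of the `l`-division field `K` of a genuine Θ-volume datum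
at `(ratPoint q, l)`, of residue characteristic `p ∉ {2, 3, 5, l}`, provided that at the place of `ℚ` over `p` the Legendre curve
`y² = x(x−1)(x−q)` is multiplicative over `ℚ` and `ord_p q`, `ord_p(q − 1)` are even (`e(v | p) = 1` over `ℚ`,
`Fisher2016.ramificationIdx_int_rat_eq_one`): `K_u/ℚ_p` is tame of index dividing `15·l`.
[cite: Mochizuki2012, IUTchIV Thm. 1.10 proof Steps (ii)–(iii) p. 24–26] [claim: Mochizuki2012, status: disputed] -/
theorem ramificationIdx_int_dvd_fifteen_mul_ratPoint' {q : ℚ} {l : ℕ} (T : ThetaVolumeDatumAt (ratPoint q) l)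
    {p : ℕ} (hp : p ∉ ({2, 3, 5, l} : Finset ℕ))
    (hmult : ∀ v : HeightOneSpectrum (𝓞 ℚ), Rat.HeightOneSpectrum.natGenerator v = p →
      (⟨0, -(1 + q), 0, q, 0⟩ : WeierstrassCurve ℚ).HasMultiplicativeReductionAt v)
    (hev : ∀ v : HeightOneSpectrum (𝓞 ℚ), Rat.HeightOneSpectrum.natGenerator v = p →
      ∃ m : ℤ, v.valuation ℚ q = WithZero.exp (2 * m))
    (hev1 : ∀ v : HeightOneSpectrum (𝓞 ℚ), Rat.HeightOneSpectrum.natGenerator v = p →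
      ∃ m : ℤ, v.valuation ℚ (q - 1) = WithZero.exp (2 * m))
    (u : letI := T.instFieldK; letI := T.instNumberFieldK; HeightOneSpectrum (𝓞 T.K))
    (hu : letI := T.instFieldK; letI := T.instNumberFieldK; residueChar T.K u = p) :
    (letI := T.instFieldK; letI := T.instNumberFieldK
     u.asIdeal.ramificationIdx ℤ) ∣ 15 * l := by
  -- adapted from abc-iut-W-neg-1's `ramificationIdx_int_dvd_sixty_mul_ratPoint'` (GenuineTowerLocalType.lean)
  letI := T.instFieldF; letI := T.instNumberFieldF; letI := T.instAlgebraF; letI := T.instFieldK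
  letI := T.instNumberFieldK; letI := T.instAlgebraK
  set v : HeightOneSpectrum (𝓞 ℚ) := finBelow (ratPoint q).F T.F (finBelow T.F T.K u) with hvdef
  have hvp : Rat.HeightOneSpectrum.natGenerator v = p := by
    have hchar : residueChar ℚ v = p := by
      rw [hvdef]
      change residueChar (ratPoint q).F (finBelow (ratPoint q).F T.F (finBelow T.F T.K u)) = p
      rw [residueChar_finBelow, residueChar_finBelow, hu]
    have hpp : p.Prime := hchar ▸ residueChar_prime ℚ v
    have hmem : ((p : ℕ) : 𝓞 ℚ) ∈ v.asIdeal := by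
      rw [natCast_mem_asIdeal_iff_residueChar_eq v hpp]; exact hchar
    have hdvd := (Literature.NumberTheory.DiophantineGeometry.UniformABCConjecture.natCast_mem_asIdeal_iff v p).1 hmem
    exact (Nat.prime_dvd_prime_iff_eq (Rat.HeightOneSpectrum.prime_natGenerator v) hpp).1 hdvd
  have h := T.ramificationIdx_int_dvd_fifteen_mul u (by rw [hu]; exact hp) (hmult v hvp) (hev v hvp) (hev1 v hvp)
  have h1 : (finBelow (ratPoint q).F T.F (finBelow T.F T.K u)).asIdeal.ramificationIdx ℤ = 1 :=
    Literature.NumberTheory.EllipticCurves.Fisher2016.ramificationIdx_int_rat_eq_one _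
  rw [h1, one_mul] at h
  exact h

end ThetaVolumeDatumAt

end Cor22

end Literature.IUT.LogVolume

end
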